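import Summits.Parity.GeneralizedHardyLittlewood.Theses.LeeYangFibres
import Literature.NumberTheory.Sieve.LinearEquationsInPrimesOneForm
import Literature.NumberTheory.Sieve.LinearEquationsInPrimesDimOne
import Summits.Parity.GeneralizedHardyLittlewood.Theorems.LeeYangFibresPrimeCellsRelativeDimOneOne
import Literature.NumberTheory.LFunctions.RHWave0PNTProofs
import HarnessLib

/-!
# Disproof work file for crux `RelativeDimOne` (stmt-Parity-14113) — cdisprove seat, cycle 1

Crux (route `LeeYangFibres`, rank 9, derived node): the `d = 1` generalised Hardy–Littlewood statement
in von Mangoldt form with Green–Tao's Conj. 1.4 error, `|S(Ψ,K,N) − β_∞𝔖| ≤ ε(β_∞𝔖 + N)` uniformly over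
non-degenerate systems `Ψ` of `t ≥ 1` forms with `‖Ψ‖_N ≤ L` and convex `K ⊆ [-N, N]`, `N ≥ N₀(t,L,ε)`.
In §0 notation: `RelativeDimOne ↔ ∀ t L, 1 ≤ t → ∀ ε > 0, ∃ N₀, ∀ N ≥ N₀, ∀ Ψ nondeg, ‖Ψ‖_N ≤ L →
∀ K convex ⊆ box, Concl ε N Ψ K` (`crux_iff`, `Iff.rfl`).

## VERDICT (cycle 1, 2026-08-16): NO KILL — and no mis-statement. Findings, all sorry-free:

* §A LOAD-BEARING ANALYSIS — every hypothesis of the crux except `1 ≤ t` is needed; each deletion is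
  refuted by an explicit one-form witness (no number theory beyond `Λ(prime) = log p`, `Λ(1) = 0`):
  - A1 `‖Ψ‖_N ≤ L` (`relativeDimOne_false_without_size`): `ψ(n) = q·n`, `q` prime `> e^N`, `K = {(1)}`:
    `S = log q > N`, `𝔖 = 0`;
  - A2 `K ⊆ [-N,N]` (`relativeDimOne_false_without_box`): `ψ = n`, `K = [N+1, 3N+3]`: `S = 0`, `β_∞𝔖 = 2N+2`;
  - A3 `Convex K` (`relativeDimOne_false_without_convex`): `ψ = n`, `K = (0,N] ∖ ℤ`: `S = 0`, `β_∞𝔖 = N`;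
  - A4 `IsNondegenerateSystem Ψ` (`relativeDimOne_false_without_nondegenerate`): the constant form
    `ψ = 0·n + 3`, `K = [-N,N]`: `S = (2N+1) log 3`, `𝔖 = 0` (first clause `ψ̇ ≠ 0`); the second clause
    is load-bearing ON ITS OWN (§D, `relativeDimOne_false_without_nonproportional`): `Ψ = (n, n)`,
    `K = [1, N]`: `S = Σ_{n≤N} Λ(n)² ≥ ⅜ N log N` (PNT for `ϑ`, tree `chebyshevTheta_isEquivalent`, plus
    Chebyshev's `ϑ(√N) ≤ √N log 4`) against a main term `(N−1)·c`, `c = 𝔖(n,n)` an UNSPECIFIED real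
    (`limUnder` of the divergent `∏ p/(p−1)`) — refuted for every value of `c`; proportional pairs of
    ratio `≠ 1` are harmless (ratio `−1`: empty positivity region; other ratios: local obstruction), so
    "no repeated form" is the exact content of that clause here;
  - A5 `0 < ε`, A6 `∃ N₀` (sanity): `ψ = n`, `K = [½, 3/2]` resp. `N = 1`, `K = [½, 1]`.
* §B NATURAL STRENGTHENINGS REFUTED: B1 the purely relative error `ε·β_∞𝔖` (drop `+ εN`) is FALSE, and (B1′,
  `not_relativeDimOneLogSlack`) so is the absolute slack `ε log N` (one prime point `{(p)}`, `N/2 < p ≤ N`);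
  (`not_purelyRelativeDimOne`: unit segment `[½, 3/2]`, `S = Λ(1) = 0 ≠ 1 = β_∞𝔖` — short bodies carry no
  primes, only the `εN` absorbs them); B2 `N₀` uniform in `L` is FALSE (`not_relativeDimOneUniformInSize`,
  witness A1 with `L := q`); B3, by contrast, `N₀` uniform in `t` is AUTOMATIC (`relativeDimOneUniformInT_iff`:
  `‖Ψ‖_N ≥ t`, `card_le_affLinSize`, so only `t ≤ L` is inhabited). The complementary strengthening — drop the
  RELATIVE term, error `εN` — is `DimOne`, i.e. the open crux `AbsoluteUpgrade` (stmt-Parity-14116); not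
  attackable here. Quantitative frontier of B1 (prose only): an absolute slack `ε·g(N)` in place of `εN` must
  have `g(N)/log^A N → ∞` for every `A` by Maier's irregularity theorem for primes in intervals of length
  `log^A x` (H. Maier, Michigan Math. J. 32 (1985) — cited from memory, searchd rc 75 all session) — out of
  formal reach; the cheap formal lower bound is B1′ below (`not_relativeDimOneLogSlack`: slack `ε log N` is false, one
  prime point `K = {(p)}`, `N/2 < p ≤ N`); whether `g = N^δ` suffices for all `δ > 0` is open even at
  `t = 1` (Huxley: `δ > 7/12`).
* §C `1 ≤ t` is COSMETIC: the `t = 0` slice HOLDS (`relativeDimOneAtZero_holds`: lattice points of an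
  interval vs its length, `|# − vol| ≤ 1 ≤ ε(vol + N)`; tree `DimOne.exists_filter_eq_Icc`).
* WHY IT RESISTS (no cheap kill exists; recorded for the provers): (i) the `εN` slack absorbs every
  junk regime — local obstructions (`𝔖 = 0` forces `S = O(t log^{t+1} N)`: each `n` has some `ψᵢ(n)` a
  power of the obstructing prime), prime powers, non-positive values (`Λ ∘ toNat = 0`), bodies of measure
  `o(N)`; (ii) the singular product CONVERGES for every non-degenerate `d = 1` system (tree
  `tendsto_singularProductPartial_holds`), so no `limUnder` junk enters; (iii) `t = 1` is the prime number
  theorem for progressions of modulus `≤ L` on intervals of length `≍ x` — a theorem, not a target;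
  (iv) for `t ≥ 2` the crux contains the twin prime conjecture
  (`Theorems/LeeYangFibresRelativeDimOne.twinPrimeConjecture_of_relativeDimOne`), is EQUIVALENT to the
  atom `CoarseHLSlack` of the picked line (`relativeDimOne_iff_coarseHLSlack`, p90896) and its upper half
  alone forces uniform character PNT to conductor `N^{1−o(1)}` (`uniformCharPNT_of_relativeDimOne`, p92834);
  conditionally, `UnboundedSiegelZeros ∧ MatomakiMerikoski2023_pairCorrelation → ¬RelativeDimOne`
  (`Theorems/LeeYangFibresAbsoluteUpgradeIllusory.not_relativeDimOne_of_unboundedSiegelZeros`) — the only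
  disproof route in print runs through a Siegel zero, which nobody can exhibit. A finite computation cannot
  refute an `∃ N₀` statement, so no kit job was run (compute discipline).
* `-- Targets`: none — the line `SketchIdeator1` is closed modulo its atom, which IS the crux (p90896);
  the lead has no stuck stub.
* LANDED (all ACCEPTED, `--supports stmt-Parity-14113`, namespace `…Theorems.RelativeDimOne.Negative`):
  part 1 `Theorems/RelativeDimOne/Negative/RelativeDimOneLoadBearing.lean` (§0, A1–A3) p94445; part 2
  `…/RelativeDimOneLoadBearingTwo.lean` (A4–A6, B1–B2, C, C2) p94765; part 3 `…/RelativeDimOneRepeatedForm.lean`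
  (§D, B3) p94789; part 4 `…/RelativeDimOneLogSlack.lean` (B1′) p94936. Ideators / planners may import them. This work file keeps
  its own copies (namespace `…Cruxes.RelativeDimOne.Disproof`) so that it elaborates independently of the
  review queue; the landed namespace is `…Theorems.RelativeDimOne.Negative`.
-/

noncomputable section

open scoped BigOperators Classical Topology
open Finset Filter MeasureTheory Set Literature.NumberTheory.Sieve
open Summit.Parity.GeneralizedHardyLittlewood.Theses.LeeYangFibres (RelativeDimOne DimOne)

namespace Summit.Parity.GeneralizedHardyLittlewood.Cruxes.RelativeDimOne.Disproof

/-! ## §0 Vocabulary: the conclusion of the crux, one-form witnesses -/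

/-- The conclusion of the crux at the data `(ε, N, Ψ, K)`:
`|S(Ψ,K,N) − β_∞(Ψ,K)·𝔖(Ψ)| ≤ ε (β_∞ 𝔖 + N)`. -/
def Concl {t : ℕ} (ε : ℝ) (N : ℕ) (Ψ : Fin t → AffLinForm 1) (K : Set (Fin 1 → ℝ)) : Prop :=
  |vonMangoldtSum Ψ K N - archFactor Ψ K * singularProduct Ψ| ≤
    ε * (archFactor Ψ K * singularProduct Ψ + N)

/-- The crux, verbatim, is the `Concl`-statement with all six hypotheses
(`1 ≤ t`, `0 < ε`, `N₀ ≤ N`, non-degeneracy, size `≤ L`, convexity, `K ⊆ [-N,N]`). -/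
theorem crux_iff :
    RelativeDimOne ↔
      ∀ (t L : ℕ), 1 ≤ t → ∀ ε : ℝ, 0 < ε → ∃ N₀ : ℕ, ∀ N : ℕ, N₀ ≤ N →
        ∀ Ψ : Fin t → AffLinForm 1, IsNondegenerateSystem Ψ → affLinSize Ψ N ≤ L →
          ∀ K : Set (Fin 1 → ℝ), Convex ℝ K → K ⊆ realBox 1 N → Concl ε N Ψ K :=
  Iff.rfl

/-- The one-form system `ψ(n) = a n + b`. -/
def lin (a b : ℤ) : Fin 1 → AffLinForm 1 := fun _ => ⟨fun _ => a, b⟩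

/-- `ψ(n) = a n₀ + b`. -/
theorem lin_eval (a b : ℤ) (i : Fin 1) (n : Fin 1 → ℤ) : (lin a b i).eval n = a * n 0 + b := by
  simp [lin, AffLinForm.eval]

/-- `ψ(x) = a x₀ + b` on `ℝ¹`. -/
theorem lin_realEval (a b : ℤ) (i : Fin 1) (x : Fin 1 → ℝ) :
    (lin a b i).realEval x = (a : ℝ) * x 0 + b := by
  simp [lin, AffLinForm.realEval]

/-- `ψ(n) = a n + b` with `a ≠ 0` is a non-degenerate system (one form: the pairwise clause is empty). -/
theorem isNondegenerateSystem_lin {a : ℤ} (ha : a ≠ 0) (b : ℤ) : IsNondegenerateSystem (lin a b) := by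
  refine ⟨fun i h => ha ?_, fun i j hij => absurd (Subsingleton.elim i j) hij⟩
  have := congr_fun h 0
  simpa [lin] using this

/-- `‖a n + b‖_N = |a| + |b/N|`. -/
theorem affLinSize_lin (a b : ℤ) (N : ℝ) : affLinSize (lin a b) N = |(a : ℝ)| + |(b : ℝ) / N| := by
  simp [affLinSize, lin]

/-- `𝔖(a n + b) = 𝟙[gcd(a,b) = 1]·|a|/φ(|a|)` (tree: `OneForm.singularProduct_eq`). -/
theorem singularProduct_lin {a : ℤ} (ha : a ≠ 0) (b : ℤ) :
    singularProduct (lin a b) =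
      if Int.gcd a b = 1 then ((a.natAbs : ℕ) : ℝ) / Nat.totient a.natAbs else 0 :=
  OneForm.singularProduct_eq (lin a b) (by simpa [lin] using ha)

/-- `𝔖(n) = 1`. -/
theorem singularProduct_id : singularProduct (lin 1 0) = 1 := by
  rw [singularProduct_lin one_ne_zero]
  simp

/-- `𝔖(q n) = 0` for `q ≥ 2` (local obstruction at every prime factor of `q`). -/
theorem singularProduct_scaled {q : ℕ} (hq : 2 ≤ q) : singularProduct (lin q 0) = 0 := by
  rw [singularProduct_lin (by exact_mod_cast (show q ≠ 0 by omega))]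
  have : Int.gcd (q : ℤ) 0 ≠ 1 := by
    rw [Int.gcd_zero_right, Int.natAbs_natCast]
    omega
  rw [if_neg this]

/-- The singleton body `{(1)} ⊆ ℝ¹`. -/
def pt : Set (Fin 1 → ℝ) := {fun _ => (1 : ℝ)}

/-- A singleton is convex. -/
theorem convex_pt : Convex ℝ pt := convex_singleton _

/-- `{(1)} ⊆ [-N, N]` for `N ≥ 1`. -/
theorem pt_subset_realBox {N : ℕ} (hN : 1 ≤ N) : pt ⊆ realBox 1 N := by
  intro x hx
  rw [pt, Set.mem_singleton_iff] at hx
  subst hx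
  have hN' : (1 : ℝ) ≤ N := by exact_mod_cast hN
  simp only [realBox, Set.mem_Icc]
  refine ⟨fun _ => ?_, fun _ => ?_⟩ <;> simp <;> linarith

/-- The lattice points of the box with real point in `pt` are exactly `{(1)}` (for `N ≥ 1`). -/
theorem filter_pt {N : ℕ} (hN : 1 ≤ N) :
    (latticeBox 1 N).filter (fun n => realPoint n ∈ pt) = {fun _ => (1 : ℤ)} := by
  ext n
  simp only [Finset.mem_filter, Finset.mem_singleton, pt, Set.mem_singleton_iff, latticeBox,
    Fintype.mem_piFinset, Finset.mem_Icc]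
  constructor
  · rintro ⟨-, h⟩
    funext i
    have hi := congr_fun h i
    simp only [realPoint] at hi
    exact_mod_cast hi
  · rintro rfl
    refine ⟨fun i => ?_, ?_⟩
    · show -(N : ℤ) ≤ 1 ∧ (1 : ℤ) ≤ N
      omega
    · funext i
      simp [realPoint]

/-- `S(q·n, {(1)}, N) = Λ(q)` for `N ≥ 1`. -/
theorem vonMangoldtSum_scaled_pt (q : ℕ) {N : ℕ} (hN : 1 ≤ N) :
    vonMangoldtSum (lin q 0) pt N = ArithmeticFunction.vonMangoldt q := by
  unfold vonMangoldtSum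
  rw [filter_pt hN, Finset.sum_singleton]
  simp [lin_eval, intVonMangoldt]

/-- At the data `(q·n, {(1)})` with `q` prime and `log q > N ≥ 1` the conclusion fails at `ε = 1`:
`S = log q`, main term `β_∞ · 0 = 0`. -/
theorem not_concl_scaled_pt {q N : ℕ} (hq : q.Prime) (hN : 1 ≤ N) (hlog : (N : ℝ) < Real.log q) :
    ¬ Concl 1 N (lin q 0) pt := by
  unfold Concl
  rw [vonMangoldtSum_scaled_pt q hN, singularProduct_scaled hq.two_le,
    ArithmeticFunction.vonMangoldt_apply_prime hq]
  simp only [mul_zero, sub_zero, zero_add, one_mul, not_le]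
  exact lt_of_lt_of_le hlog (le_abs_self _)

/-- A prime `q` with `log q > N`. -/
theorem exists_prime_log_gt (N : ℕ) : ∃ q : ℕ, q.Prime ∧ (N : ℝ) < Real.log q := by
  obtain ⟨q, hq, hqp⟩ := Nat.exists_infinite_primes (⌈Real.exp N⌉₊ + 1)
  refine ⟨q, hqp, ?_⟩
  have h1 : Real.exp N < q := by
    have := Nat.le_ceil (Real.exp N)
    have h2 : ((⌈Real.exp N⌉₊ + 1 : ℕ) : ℝ) ≤ q := by exact_mod_cast hq
    push_cast at h2
    linarith
  calc (N : ℝ) = Real.log (Real.exp N) := (Real.log_exp _).symm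
    _ < Real.log q := Real.log_lt_log (Real.exp_pos _) h1

/-! ## §A Load-bearing hypotheses: the crux with one hypothesis deleted is FALSE -/

/-! ### A1. The size bound `‖Ψ‖_N ≤ L` -/

/-- The crux with the size hypothesis `affLinSize Ψ N ≤ L` (and the then idle parameter `L`) deleted. -/
def RelativeDimOneWithoutSize : Prop :=
  ∀ t : ℕ, 1 ≤ t → ∀ ε : ℝ, 0 < ε → ∃ N₀ : ℕ, ∀ N : ℕ, N₀ ≤ N →
    ∀ Ψ : Fin t → AffLinForm 1, IsNondegenerateSystem Ψ →
      ∀ K : Set (Fin 1 → ℝ), Convex ℝ K → K ⊆ realBox 1 N → Concl ε N Ψ K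

/-- Sanity: the variant is the crux minus a hypothesis (it implies the crux). -/
theorem relativeDimOneWithoutSize_imp : RelativeDimOneWithoutSize → RelativeDimOne := by
  intro h t L ht ε hε
  obtain ⟨N₀, hN₀⟩ := h t ht ε hε
  exact ⟨N₀, fun N hN Ψ hΨ _ K hK hKN => hN₀ N hN Ψ hΨ K hK hKN⟩

/-- **The size bound is load-bearing.** Witness: `t = 1`, `ψ(n) = q n` with `q` a prime `> e^N`,
`K = {(1)}`: `S = Λ(q) = log q > N` while `𝔖 = 0` (`β_q = 0`), so `|S − 0| ≤ 1·(0 + N)` fails.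
(Any proof must use `‖Ψ‖_N ≤ L`: it is what bounds the values, hence each `Λ`, by `log((L+1)N)`.) -/
theorem relativeDimOne_false_without_size : ¬ RelativeDimOneWithoutSize := by
  intro h
  obtain ⟨N₀, hN₀⟩ := h 1 le_rfl 1 one_pos
  obtain ⟨q, hq, hlog⟩ := exists_prime_log_gt (max N₀ 1)
  have hq0 : (q : ℤ) ≠ 0 := by exact_mod_cast hq.ne_zero
  exact not_concl_scaled_pt hq (le_max_right _ _) hlog
    (hN₀ (max N₀ 1) (le_max_left _ _) (lin q 0) (isNondegenerateSystem_lin hq0 0) pt convex_pt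
      (pt_subset_realBox (le_max_right _ _)))

/-! ### A2. The body constraint `K ⊆ [-N, N]` -/

/-- The crux with the hypothesis `K ⊆ realBox 1 N` deleted. -/
def RelativeDimOneWithoutBox : Prop :=
  ∀ (t L : ℕ), 1 ≤ t → ∀ ε : ℝ, 0 < ε → ∃ N₀ : ℕ, ∀ N : ℕ, N₀ ≤ N →
    ∀ Ψ : Fin t → AffLinForm 1, IsNondegenerateSystem Ψ → affLinSize Ψ N ≤ L →
      ∀ K : Set (Fin 1 → ℝ), Convex ℝ K → Concl ε N Ψ K

/-- Sanity: the variant is the crux minus a hypothesis (it implies the crux). -/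
theorem relativeDimOneWithoutBox_imp : RelativeDimOneWithoutBox → RelativeDimOne := by
  intro h t L ht ε hε
  obtain ⟨N₀, hN₀⟩ := h t L ht ε hε
  exact ⟨N₀, fun N hN Ψ hΨ hL K hK _ => hN₀ N hN Ψ hΨ hL K hK⟩

/-- The interval body `[a, b] ⊆ ℝ¹`. -/
def seg (a b : ℝ) : Set (Fin 1 → ℝ) := Set.Icc (fun _ => a) (fun _ => b)

/-- Segments are convex. -/
theorem convex_seg (a b : ℝ) : Convex ℝ (seg a b) := convex_Icc _ _

/-- Membership in a segment of `ℝ¹`. -/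
theorem mem_seg {a b : ℝ} {x : Fin 1 → ℝ} : x ∈ seg a b ↔ a ≤ x 0 ∧ x 0 ≤ b := by
  simp only [seg, Set.mem_Icc, Pi.le_def, Fin.forall_fin_one]

/-- A segment inside `[-N, N]`. -/
theorem seg_subset_realBox {a b : ℝ} {N : ℕ} (ha : -(N : ℝ) ≤ a) (hb : b ≤ N) :
    seg a b ⊆ realBox 1 N := by
  intro x hx
  rw [mem_seg] at hx
  simp only [realBox, Set.mem_Icc, Pi.le_def, Fin.forall_fin_one]
  exact ⟨by linarith [hx.1], by linarith [hx.2]⟩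

/-- `β_∞(n; [a,b]) = b − a` for `0 < a ≤ b` (the whole segment lies in `{x > 0}`). -/
theorem archFactor_id_seg {a b : ℝ} (ha : 0 < a) (hab : a ≤ b) :
    archFactor (lin 1 0) (seg a b) = b - a := by
  unfold archFactor
  have hset : seg a b ∩ {x | ∀ i, 0 < (lin 1 0 i).realEval x} = seg a b := by
    refine Set.inter_eq_left.mpr fun x hx i => ?_
    rw [mem_seg] at hx
    rw [lin_realEval]
    push_cast
    linarith [hx.1]
  rw [hset, seg, Real.volume_Icc_pi_toReal (fun _ => hab)]
  simp

/-- If no lattice point of the box has its real point in `K`, the sum `S` vanishes. -/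
theorem vonMangoldtSum_eq_zero_of_forall {t : ℕ} (Ψ : Fin t → AffLinForm 1) {K : Set (Fin 1 → ℝ)}
    {N : ℕ} (h : ∀ n ∈ latticeBox 1 N, realPoint n ∈ K → ∏ i, intVonMangoldt ((Ψ i).eval n) = 0) :
    vonMangoldtSum Ψ K N = 0 := by
  unfold vonMangoldtSum
  refine Finset.sum_eq_zero fun n hn => ?_
  rw [Finset.mem_filter] at hn
  exact h n hn.1 hn.2

/-- Lattice points of the box `[-N, N]¹`. -/
theorem mem_latticeBox_one {N : ℕ} {n : Fin 1 → ℤ} (hn : n ∈ latticeBox 1 N) :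
    -(N : ℤ) ≤ n 0 ∧ n 0 ≤ N := by
  simpa [latticeBox, Fintype.mem_piFinset] using hn

/-- **`K ⊆ [-N, N]` is load-bearing.** Witness: `t = 1`, `ψ(n) = n`, `K = [N+1, 3N+3]` (convex,
outside the box): `S = 0` (no lattice point of `[-N,N]` lies in `K`) while `β_∞ 𝔖 = 2N + 2`, so
`|0 − (2N+2)| ≤ ½ (2N + 2 + N)` fails. (The sum only sees the box; the main term sees all of `K`.) -/
theorem relativeDimOne_false_without_box : ¬ RelativeDimOneWithoutBox := by
  intro h
  obtain ⟨N₀, hN₀⟩ := h 1 1 le_rfl (1 / 2) (by norm_num)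
  set N := max N₀ 1 with hNdef
  have hN1 : 1 ≤ N := le_max_right _ _
  have hNr : (1 : ℝ) ≤ N := by exact_mod_cast hN1
  have key := hN₀ N (le_max_left _ _) (lin 1 0) (isNondegenerateSystem_lin one_ne_zero 0)
    (by rw [affLinSize_lin]; simp) (seg ((N : ℝ) + 1) (3 * N + 3)) (convex_seg _ _)
  unfold Concl at key
  rw [archFactor_id_seg (by linarith) (by linarith), singularProduct_id,
    vonMangoldtSum_eq_zero_of_forall] at key
  · rw [mul_one, zero_sub, abs_neg, abs_of_nonneg (by linarith)] at key
    linarith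
  · intro n hn hK
    exfalso
    have h1 := (mem_latticeBox_one hn).2
    have h2 := (mem_seg.mp hK).1
    simp only [realPoint] at h2
    have h3 : ((n 0 : ℤ) : ℝ) ≤ N := by exact_mod_cast h1
    linarith

/-! ### A3. Convexity of `K` -/

/-- The crux with the hypothesis `Convex ℝ K` deleted. -/
def RelativeDimOneWithoutConvex : Prop :=
  ∀ (t L : ℕ), 1 ≤ t → ∀ ε : ℝ, 0 < ε → ∃ N₀ : ℕ, ∀ N : ℕ, N₀ ≤ N →
    ∀ Ψ : Fin t → AffLinForm 1, IsNondegenerateSystem Ψ → affLinSize Ψ N ≤ L →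
      ∀ K : Set (Fin 1 → ℝ), K ⊆ realBox 1 N → Concl ε N Ψ K

/-- Sanity: the variant is the crux minus a hypothesis (it implies the crux). -/
theorem relativeDimOneWithoutConvex_imp : RelativeDimOneWithoutConvex → RelativeDimOne := by
  intro h t L ht ε hε
  obtain ⟨N₀, hN₀⟩ := h t L ht ε hε
  exact ⟨N₀, fun N hN Ψ hΨ hL K _ hKN => hN₀ N hN Ψ hΨ hL K hKN⟩

/-- The punctured body `(0, N] ∖ ℤ ⊆ ℝ¹`: full measure `N`, no lattice point. -/
def punctured (N : ℕ) : Set (Fin 1 → ℝ) :=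
  Set.pi Set.univ (fun _ : Fin 1 => Set.Ioc (0 : ℝ) N) \ ⋃ z : ℤ, {x | x 0 = (z : ℝ)}

/-- `(0, N] ∖ ℤ ⊆ [-N, N]`. -/
theorem punctured_subset_realBox (N : ℕ) : punctured N ⊆ realBox 1 N := by
  intro x hx
  have hx1 := hx.1
  simp only [Set.mem_pi, Set.mem_univ, true_implies, Set.mem_Ioc] at hx1
  simp only [realBox, Set.mem_Icc, Pi.le_def]
  have hN : (0 : ℝ) ≤ N := Nat.cast_nonneg N
  exact ⟨fun i => by linarith [(hx1 i).1], fun i => (hx1 i).2⟩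

/-- The hyperplanes `{x₀ = z}`, `z ∈ ℤ`, of `ℝ¹` form a null set. -/
theorem volume_iUnion_intSlices : volume (⋃ z : ℤ, {x : Fin 1 → ℝ | x 0 = (z : ℝ)}) = 0 := by
  refine measure_iUnion_null_iff.mpr fun z => ?_
  refine measure_mono_null (t := Set.Icc (fun _ => (z : ℝ)) (fun _ => (z : ℝ))) ?_ ?_
  · intro x hx
    simp only [Set.mem_setOf_eq] at hx
    simp only [Set.mem_Icc, Pi.le_def, Fin.forall_fin_one, hx, le_refl, and_self]
  · rw [Real.volume_Icc_pi]
    simp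

/-- `β_∞(n; (0,N] ∖ ℤ) = N`. -/
theorem archFactor_id_punctured (N : ℕ) : archFactor (lin 1 0) (punctured N) = N := by
  unfold archFactor
  have hset : punctured N ∩ {x | ∀ i, 0 < (lin 1 0 i).realEval x} = punctured N := by
    refine Set.inter_eq_left.mpr fun x hx i => ?_
    have hx1 := hx.1
    simp only [Set.mem_pi, Set.mem_univ, true_implies, Set.mem_Ioc] at hx1
    rw [lin_realEval]
    push_cast
    linarith [(hx1 0).1]
  rw [hset, punctured, measure_sdiff_null volume_iUnion_intSlices,
    Real.volume_pi_Ioc_toReal (fun _ => Nat.cast_nonneg N)]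
  simp

/-- **Convexity is load-bearing.** Witness: `t = 1`, `ψ(n) = n`, `K = (0, N] ∖ ℤ` (in the box, not
convex): `S = 0` (no lattice point) while `β_∞ 𝔖 = N·1`, so `|0 − N| ≤ ¼ (N + N)` fails for `N ≥ 1`.
(Convexity is what ties the lattice-point count of `K` to its volume.) -/
theorem relativeDimOne_false_without_convex : ¬ RelativeDimOneWithoutConvex := by
  intro h
  obtain ⟨N₀, hN₀⟩ := h 1 1 le_rfl (1 / 4) (by norm_num)
  set N := max N₀ 1 with hNdef
  have hN1 : 1 ≤ N := le_max_right _ _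
  have hNr : (1 : ℝ) ≤ N := by exact_mod_cast hN1
  have key := hN₀ N (le_max_left _ _) (lin 1 0) (isNondegenerateSystem_lin one_ne_zero 0)
    (by rw [affLinSize_lin]; simp) (punctured N) (punctured_subset_realBox N)
  unfold Concl at key
  rw [archFactor_id_punctured, singularProduct_id, vonMangoldtSum_eq_zero_of_forall] at key
  · rw [mul_one, zero_sub, abs_neg, abs_of_nonneg (by linarith)] at key
    linarith
  · intro n _ hK
    exfalso
    have h2 := hK.2
    apply h2
    simp only [Set.mem_iUnion, Set.mem_setOf_eq, realPoint]
    exact ⟨n 0, rfl⟩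

/-! ### A4. Non-degeneracy of `Ψ` -/

/-- The crux with the hypothesis `IsNondegenerateSystem Ψ` deleted. -/
def RelativeDimOneWithoutNondegenerate : Prop :=
  ∀ (t L : ℕ), 1 ≤ t → ∀ ε : ℝ, 0 < ε → ∃ N₀ : ℕ, ∀ N : ℕ, N₀ ≤ N →
    ∀ Ψ : Fin t → AffLinForm 1, affLinSize Ψ N ≤ L →
      ∀ K : Set (Fin 1 → ℝ), Convex ℝ K → K ⊆ realBox 1 N → Concl ε N Ψ K

/-- Sanity: the variant is the crux minus a hypothesis (it implies the crux). -/
theorem relativeDimOneWithoutNondegenerate_imp :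
    RelativeDimOneWithoutNondegenerate → RelativeDimOne := by
  intro h t L ht ε hε
  obtain ⟨N₀, hN₀⟩ := h t L ht ε hε
  exact ⟨N₀, fun N hN Ψ _ hL K hK hKN => hN₀ N hN Ψ hL K hK hKN⟩

/-- `𝔖(0·n + 3) = 0`: the local factor at `3` vanishes, so all partial products from `x = 3` on are
`0` and the ordered limit is `0` (no non-degeneracy is needed for an eventually constant sequence). -/
theorem singularProduct_const_three : singularProduct (lin 0 3) = 0 := by
  have hβ : localFactor (lin 0 3) 3 = 0 := by
    rw [OneForm.localFactor_eq (lin 0 3) Nat.prime_three]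
    simp [lin]
  have hev : ∀ x : ℕ, 3 ≤ x → singularProductPartial (lin 0 3) x = 0 := fun x hx =>
    Finset.prod_eq_zero (Nat.mem_primesLE.mpr ⟨hx, Nat.prime_three⟩) hβ
  have hlim : Tendsto (singularProductPartial (lin 0 3)) atTop (𝓝 0) :=
    tendsto_const_nhds.congr' (eventually_atTop.2 ⟨3, fun x hx => (hev x hx).symm⟩)
  rw [singularProduct, hlim.limUnder_eq]

/-- `S(3; [-N,N], N) = (2N+1)·log 3`: every lattice point of the box contributes `Λ(3)`. -/
theorem vonMangoldtSum_const_three (N : ℕ) :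
    vonMangoldtSum (lin 0 3) (realBox 1 N) N = (2 * N + 1) * Real.log 3 := by
  unfold vonMangoldtSum
  rw [Finset.filter_true_of_mem]
  swap
  · intro n hn
    have hn' := mem_latticeBox_one hn
    simp only [realBox, Set.mem_Icc, Pi.le_def, Fin.forall_fin_one, realPoint]
    exact ⟨by exact_mod_cast hn'.1, by exact_mod_cast hn'.2⟩
  have hterm : ∀ n ∈ latticeBox 1 N, ∏ i, intVonMangoldt ((lin 0 3 i).eval n) = Real.log 3 := by
    intro n _
    simp [lin_eval, intVonMangoldt, ArithmeticFunction.vonMangoldt_apply_prime Nat.prime_three]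
  rw [Finset.sum_congr rfl hterm, Finset.sum_const, nsmul_eq_mul]
  congr 1
  rw [latticeBox, Fintype.card_piFinset, Finset.prod_const, Finset.card_univ, Fintype.card_fin,
    pow_one, Int.card_Icc]
  have : ((N : ℤ) + 1 - -(N : ℤ)).toNat = 2 * N + 1 := by omega
  rw [this]
  push_cast
  ring

/-- **Non-degeneracy is load-bearing.** Witness: `t = 1`, the CONSTANT form `ψ(n) = 0·n + 3`
(`‖Ψ‖_N = 3/N ≤ 3`), `K = [-N, N]`: `S = (2N+1) log 3` while `𝔖 = 0` (`β_3 = 0`), so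
`|S − 0| ≤ 1·(0 + N)` fails. (Deleting only the first clause `ψ̇ᵢ ≠ 0` of `IsNondegenerateSystem`
already breaks the statement; for the second clause see §D, witness `(n, n)`.) -/
theorem relativeDimOne_false_without_nondegenerate : ¬ RelativeDimOneWithoutNondegenerate := by
  intro h
  obtain ⟨N₀, hN₀⟩ := h 1 3 le_rfl 1 one_pos
  set N := max N₀ 1 with hNdef
  have hN1 : 1 ≤ N := le_max_right _ _
  have hNr : (1 : ℝ) ≤ N := by exact_mod_cast hN1
  have hsize : affLinSize (lin 0 3) N ≤ 3 := by
    rw [affLinSize_lin]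
    simp only [Int.cast_zero, abs_zero, zero_add, Int.cast_ofNat]
    rw [abs_of_nonneg (by positivity), div_le_iff₀ (by linarith)]
    linarith
  have key := hN₀ N (le_max_left _ _) (lin 0 3) hsize (realBox 1 N) (convex_Icc _ _) subset_rfl
  unfold Concl at key
  rw [vonMangoldtSum_const_three, singularProduct_const_three] at key
  simp only [mul_zero, sub_zero, zero_add, one_mul] at key
  have hlog3 : (1 : ℝ) < Real.log 3 := by
    rw [Real.lt_log_iff_exp_lt (by norm_num)]
    have := Real.exp_one_lt_d9
    linarith
  have hpos : (0 : ℝ) ≤ (2 * N + 1) * Real.log 3 := by positivity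
  rw [abs_of_nonneg hpos] at key
  nlinarith

/-! ### A5. Positivity of `ε` -/

/-- The crux with the hypothesis `0 < ε` deleted. -/
def RelativeDimOneWithoutEpsPos : Prop :=
  ∀ (t L : ℕ), 1 ≤ t → ∀ ε : ℝ, ∃ N₀ : ℕ, ∀ N : ℕ, N₀ ≤ N →
    ∀ Ψ : Fin t → AffLinForm 1, IsNondegenerateSystem Ψ → affLinSize Ψ N ≤ L →
      ∀ K : Set (Fin 1 → ℝ), Convex ℝ K → K ⊆ realBox 1 N → Concl ε N Ψ K

/-- Sanity: the variant is the crux minus a hypothesis (it implies the crux). -/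
theorem relativeDimOneWithoutEpsPos_imp : RelativeDimOneWithoutEpsPos → RelativeDimOne := by
  intro h t L ht ε _
  exact h t L ht ε

/-- `S(n; [½, c], N) = 0` for `c < 2`: the only lattice point is `n = 1`, and `Λ(1) = 0`. -/
theorem vonMangoldtSum_id_seg_half {c : ℝ} (hc : c < 2) (N : ℕ) :
    vonMangoldtSum (lin 1 0) (seg (1 / 2) c) N = 0 := by
  refine vonMangoldtSum_eq_zero_of_forall _ fun n _ hK => ?_
  have h := mem_seg.mp hK
  simp only [realPoint] at h
  have h1 : (0 : ℝ) < n 0 := by linarith [h.1]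
  have h2 : ((n 0 : ℤ) : ℝ) < 2 := by linarith [h.2]
  have h3 : n 0 = 1 := by
    have : (0 : ℤ) < n 0 := by exact_mod_cast h1
    have : n 0 < 2 := by exact_mod_cast h2
    omega
  simp [lin_eval, intVonMangoldt, h3]

/-- At `(n; [½, 3/2])`, `N ≥ 2`: `S = 0`, `β_∞ 𝔖 = 1`, so `Concl ε` reads `1 ≤ ε (1 + N)`. -/
theorem concl_id_seg_half_iff {ε : ℝ} {N : ℕ} :
    Concl ε N (lin 1 0) (seg (1 / 2) (3 / 2)) ↔ 1 ≤ ε * (1 + N) := by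
  unfold Concl
  rw [vonMangoldtSum_id_seg_half (by norm_num), archFactor_id_seg (by norm_num) (by norm_num),
    singularProduct_id]
  norm_num

/-- **`0 < ε` is load-bearing** (sanity). Witness at `ε = 0`: `ψ(n) = n`, `K = [½, 3/2]`:
`S = Λ(1) = 0 ≠ 1 = β_∞ 𝔖`. -/
theorem relativeDimOne_false_without_epsPos : ¬ RelativeDimOneWithoutEpsPos := by
  intro h
  obtain ⟨N₀, hN₀⟩ := h 1 1 le_rfl 0
  set N := max N₀ 2 with hNdef
  have hN2 : 2 ≤ N := le_max_right _ _
  have hNr : (2 : ℝ) ≤ N := by exact_mod_cast hN2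
  have key := hN₀ N (le_max_left _ _) (lin 1 0) (isNondegenerateSystem_lin one_ne_zero 0)
    (by rw [affLinSize_lin]; simp) (seg (1 / 2) (3 / 2)) (convex_seg _ _)
    (seg_subset_realBox (by linarith) (by linarith))
  rw [concl_id_seg_half_iff] at key
  linarith

/-! ### A6. The threshold `N₀` -/

/-- The crux with `∃ N₀, ∀ N ≥ N₀` replaced by `∀ N`. -/
def RelativeDimOneWithoutThreshold : Prop :=
  ∀ (t L : ℕ), 1 ≤ t → ∀ ε : ℝ, 0 < ε → ∀ N : ℕ,
    ∀ Ψ : Fin t → AffLinForm 1, IsNondegenerateSystem Ψ → affLinSize Ψ N ≤ L →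
      ∀ K : Set (Fin 1 → ℝ), Convex ℝ K → K ⊆ realBox 1 N → Concl ε N Ψ K

/-- Sanity: the variant is the crux minus a hypothesis (it implies the crux). -/
theorem relativeDimOneWithoutThreshold_imp : RelativeDimOneWithoutThreshold → RelativeDimOne := by
  intro h t L ht ε hε
  exact ⟨0, fun N _ => h t L ht ε hε N⟩

/-- **The threshold is load-bearing** (sanity; no junk used). Witness at `N = 1`: `ψ(n) = n`,
`K = [½, 1] ⊆ [-1, 1]`: `S = Λ(1) = 0`, `β_∞ 𝔖 = ½`, and `½ ≤ ¼ (½ + 1)` fails. (At `N = 0` the size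
`‖Ψ‖_0` even forgets the constants, `|b/0| = 0` in Lean — provers take `N₀ ≥ 1`.) -/
theorem relativeDimOne_false_without_threshold : ¬ RelativeDimOneWithoutThreshold := by
  intro h
  have key := h 1 1 le_rfl (1 / 4) (by norm_num) 1 (lin 1 0) (isNondegenerateSystem_lin one_ne_zero 0)
    (by rw [affLinSize_lin]; simp) (seg (1 / 2) 1) (convex_seg _ _)
    (seg_subset_realBox (by norm_num) (by norm_num))
  unfold Concl at key
  rw [vonMangoldtSum_id_seg_half (by norm_num), archFactor_id_seg (by norm_num) (by norm_num),
    singularProduct_id] at key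
  norm_num [abs_of_pos] at key

/-! ## §B Natural strengthenings that are FALSE -/

/-! ### B1. Purely relative error (drop the `+ N`) -/

/-- The crux with the conclusion strengthened to a purely RELATIVE error `ε · β_∞ 𝔖`. -/
def PurelyRelativeDimOne : Prop :=
  ∀ (t L : ℕ), 1 ≤ t → ∀ ε : ℝ, 0 < ε → ∃ N₀ : ℕ, ∀ N : ℕ, N₀ ≤ N →
    ∀ Ψ : Fin t → AffLinForm 1, IsNondegenerateSystem Ψ → affLinSize Ψ N ≤ L →
      ∀ K : Set (Fin 1 → ℝ), Convex ℝ K → K ⊆ realBox 1 N →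
        |vonMangoldtSum Ψ K N - archFactor Ψ K * singularProduct Ψ| ≤
          ε * (archFactor Ψ K * singularProduct Ψ)

/-- **The absolute slack `+ εN` cannot be dropped.** Witness: `ψ(n) = n`, `K = [½, 3/2]` (unit
length, one lattice point `1`, `Λ(1) = 0`): `|0 − 1| ≤ ε·1` fails for `ε = ½` at every `N ≥ 2`. Short
bodies carry no primes; only the `εN` absorbs them. -/
theorem not_purelyRelativeDimOne : ¬ PurelyRelativeDimOne := by
  intro h
  obtain ⟨N₀, hN₀⟩ := h 1 1 le_rfl (1 / 2) (by norm_num)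
  set N := max N₀ 2 with hNdef
  have hN2 : 2 ≤ N := le_max_right _ _
  have hNr : (2 : ℝ) ≤ N := by exact_mod_cast hN2
  have key := hN₀ N (le_max_left _ _) (lin 1 0) (isNondegenerateSystem_lin one_ne_zero 0)
    (by rw [affLinSize_lin]; simp) (seg (1 / 2) (3 / 2)) (convex_seg _ _)
    (seg_subset_realBox (by linarith) (by linarith))
  rw [vonMangoldtSum_id_seg_half (by norm_num), archFactor_id_seg (by norm_num) (by norm_num),
    singularProduct_id] at key
  norm_num [abs_of_pos] at key

/-! ### B2. A threshold uniform in the size `L` -/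

/-- The crux with `N₀` chosen BEFORE `L` (uniformity in the size of the system). -/
def RelativeDimOneUniformInSize : Prop :=
  ∀ t : ℕ, 1 ≤ t → ∀ ε : ℝ, 0 < ε → ∃ N₀ : ℕ, ∀ L : ℕ, ∀ N : ℕ, N₀ ≤ N →
    ∀ Ψ : Fin t → AffLinForm 1, IsNondegenerateSystem Ψ → affLinSize Ψ N ≤ L →
      ∀ K : Set (Fin 1 → ℝ), Convex ℝ K → K ⊆ realBox 1 N → Concl ε N Ψ K

/-- Sanity: the variant strengthens the crux (it implies the crux). -/
theorem relativeDimOneUniformInSize_imp : RelativeDimOneUniformInSize → RelativeDimOne := by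
  intro h t L ht ε hε
  obtain ⟨N₀, hN₀⟩ := h t ht ε hε
  exact ⟨N₀, hN₀ L⟩

/-- **`N₀` must depend on `L`.** Same witness as A1 with `L := q`: `ψ(n) = q n`, `q` prime `> e^N`,
`‖Ψ‖_N = q ≤ L`, `K = {(1)}`, `S = log q > N = 1·(0 + N)`. -/
theorem not_relativeDimOneUniformInSize : ¬ RelativeDimOneUniformInSize := by
  intro h
  obtain ⟨N₀, hN₀⟩ := h 1 le_rfl 1 one_pos
  obtain ⟨q, hq, hlog⟩ := exists_prime_log_gt (max N₀ 1)
  have hq0 : (q : ℤ) ≠ 0 := by exact_mod_cast hq.ne_zero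
  refine not_concl_scaled_pt hq (le_max_right _ _) hlog
    (hN₀ q (max N₀ 1) (le_max_left _ _) (lin q 0) (isNondegenerateSystem_lin hq0 0) ?_ pt convex_pt
      (pt_subset_realBox (le_max_right _ _)))
  rw [affLinSize_lin]
  simp

/-! ## §C The hypothesis `1 ≤ t` is NOT load-bearing: the `t = 0` slice is TRUE -/

/-- The crux body at `t = 0` (empty system: `S` = number of lattice points of `K`, `β_∞ = vol K`,
`𝔖 = 1`). -/
def RelativeDimOneAtZero : Prop :=
  ∀ L : ℕ, ∀ ε : ℝ, 0 < ε → ∃ N₀ : ℕ, ∀ N : ℕ, N₀ ≤ N →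
    ∀ Ψ : Fin 0 → AffLinForm 1, IsNondegenerateSystem Ψ → affLinSize Ψ N ≤ L →
      ∀ K : Set (Fin 1 → ℝ), Convex ℝ K → K ⊆ realBox 1 N → Concl ε N Ψ K

/-- `𝔖(∅) = 1`: every local factor of the empty system is `p⁻¹ · p = 1`. -/
theorem singularProduct_fin_zero (Ψ : Fin 0 → AffLinForm 1) : singularProduct Ψ = 1 := by
  have hβ : ∀ p : ℕ, p.Prime → localFactor Ψ p = 1 := by
    intro p hp
    unfold localFactor
    simp only [Finset.univ_eq_empty, Finset.prod_empty, Finset.sum_const, Fintype.card_piFinset,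
      Finset.card_range, nsmul_eq_mul, mul_one, pow_one]
    have hp0 : (p : ℝ) ≠ 0 := by exact_mod_cast hp.ne_zero
    simp [hp0]
  have hev : ∀ x : ℕ, singularProductPartial Ψ x = 1 := fun x =>
    Finset.prod_eq_one fun p hp => hβ p (Nat.mem_primesLE.mp hp).2
  have hlim : Tendsto (singularProductPartial Ψ) atTop (𝓝 1) :=
    tendsto_const_nhds.congr' (Eventually.of_forall fun x => (hev x).symm)
  rw [singularProduct, hlim.limUnder_eq]

/-- `S(∅; K, N)` is the number of lattice points of `K`. -/
theorem vonMangoldtSum_fin_zero (Ψ : Fin 0 → AffLinForm 1) (K : Set (Fin 1 → ℝ)) (N : ℕ) :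
    vonMangoldtSum Ψ K N = #((latticeBox 1 N).filter (fun n => realPoint n ∈ K)) := by
  unfold vonMangoldtSum
  simp

/-- `β_∞(∅; K)` is the length of the slice of `K`. -/
theorem archFactor_fin_zero (Ψ : Fin 0 → AffLinForm 1) (K : Set (Fin 1 → ℝ)) :
    archFactor Ψ K = (volume {r : ℝ | (fun _ : Fin 1 => r) ∈ K}).toReal := by
  rw [DimOne.archFactor_eq]
  simp

/-- **The `t = 0` slice of the crux holds** (so `1 ≤ t` is cosmetic): for a convex `K ⊆ [-N, N]` the
lattice-point count and the length differ by at most `1 ≤ ε (vol K + N)` once `N ≥ 1/ε`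
(tree: `DimOne.exists_filter_eq_Icc`). -/
theorem relativeDimOneAtZero_holds : RelativeDimOneAtZero := by
  intro L ε hε
  refine ⟨⌈1 / ε⌉₊, fun N hN Ψ _ _ K hK hKN => ?_⟩
  have hNε : 1 / ε ≤ N := (Nat.le_ceil _).trans (by exact_mod_cast hN)
  have hεN : 1 ≤ ε * N := by
    rw [div_le_iff₀ hε] at hNε
    linarith
  unfold Concl
  rw [vonMangoldtSum_fin_zero, archFactor_fin_zero, singularProduct_fin_zero, mul_one,
    DimOne.card_filter_latticeBox]
  set S : Set ℝ := {r : ℝ | (fun _ : Fin 1 => r) ∈ K} with hSdef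
  have hS : S.OrdConnected := (DimOne.convex_slice hK).ordConnected
  have hSN : S ⊆ Set.Icc (-(N : ℝ)) N := by
    intro r hr
    have := hKN hr
    simp only [realBox, Set.mem_Icc, Pi.le_def, Fin.forall_fin_one] at this
    exact this
  obtain ⟨m₁, m₂, hI, hvol⟩ := DimOne.exists_filter_eq_Icc (N := N) hS hSN
  have hI' : (Finset.Icc (-(N : ℤ)) N).filter (fun m : ℤ => realPoint (fun _ : Fin 1 => m) ∈ K) =
      Finset.Icc m₁ m₂ := by
    rw [← hI]
    rfl
  rw [hI']
  have hvol0 : 0 ≤ (volume S).toReal := ENNReal.toReal_nonneg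
  calc |(#(Finset.Icc m₁ m₂) : ℝ) - (volume S).toReal| ≤ 1 := hvol
    _ ≤ ε * N := hεN
    _ ≤ ε * ((volume S).toReal + N) := by nlinarith

/-! ## §C2 The `t = 1` slice is a THEOREM (any counterexample needs `t ≥ 2`) -/

/-- The crux body at `t = 1` (primes in a segment of a progression of modulus `≤ L`). -/
def RelativeDimOneAtOne : Prop :=
  ∀ L : ℕ, ∀ ε : ℝ, 0 < ε → ∃ N₀ : ℕ, ∀ N : ℕ, N₀ ≤ N →
    ∀ Ψ : Fin 1 → AffLinForm 1, IsNondegenerateSystem Ψ → affLinSize Ψ N ≤ L →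
      ∀ K : Set (Fin 1 → ℝ), Convex ℝ K → K ⊆ realBox 1 N → Concl ε N Ψ K

/-- The crux restricted to `t = 1` is exactly `RelativeDimOneAtOne`. -/
theorem relativeDimOne_one (h : RelativeDimOne) : RelativeDimOneAtOne := fun L ε hε => h 1 L le_rfl ε hε

/-- **The `t = 1` slice of the crux HOLDS unconditionally**: the absolute form at `t = 1` is in the
tree (`PrimeCellsRelative.Sketch.stub_dimOne_one`, Green–Tao 2010 Thm. 4.5 at level `s = 1` plus the
§4 reduction — a single form has finite complexity), and absolute ⟹ relative exactly as in
`Theorems/LeeYangFibresRelativeDimOne.relativeDimOne_of_dimOne` (`S ≥ 0` forces `β_∞𝔖 ≥ −N/2`).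
Consequence for disprovers: every counterexample to the crux has `t ≥ 2` (twin-prime territory). -/
theorem relativeDimOneAtOne_holds : RelativeDimOneAtOne := by
  intro L ε hε
  obtain ⟨N₀, hN₀⟩ :=
    Summit.Parity.GeneralizedHardyLittlewood.Cruxes.PrimeCellsRelative.Sketch.stub_dimOne_one L (min ε 1 / 2)
      (by positivity)
  refine ⟨N₀, fun N hN Ψ hΨ hL K hK hKN => ?_⟩
  have hb := hN₀ N hN Ψ hΨ hL K hK hKN
  unfold Concl
  have hS : 0 ≤ vonMangoldtSum Ψ K N :=
    Finset.sum_nonneg fun n _ => Finset.prod_nonneg fun i _ => ArithmeticFunction.vonMangoldt_nonneg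
  set S := vonMangoldtSum Ψ K N with hSdef
  set M := archFactor Ψ K * singularProduct Ψ with hMdef
  have hN0 : (0 : ℝ) ≤ N := Nat.cast_nonneg N
  have hε1 : min ε 1 / 2 ≤ ε / 2 := by
    have := min_le_left ε 1
    linarith
  have hε2 : min ε 1 / 2 ≤ 1 / 2 := by
    have := min_le_right ε 1
    linarith
  have hab := abs_le.mp hb
  have hM : -(1 / 2 * (N : ℝ)) ≤ M := by
    have h1 : min ε 1 / 2 * (N : ℝ) ≤ 1 / 2 * N := mul_le_mul_of_nonneg_right hε2 hN0
    linarith [hab.1, hab.2]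
  have hεM : -(ε / 2 * (N : ℝ)) ≤ ε * M := by
    have := mul_le_mul_of_nonneg_left hM hε.le
    linarith
  have h2 : min ε 1 / 2 * (N : ℝ) ≤ ε / 2 * N := mul_le_mul_of_nonneg_right hε1 hN0
  calc |S - M| ≤ min ε 1 / 2 * (N : ℝ) := hb
    _ ≤ ε * (M + N) := by nlinarith

/-! ## §D The second clause of non-degeneracy: the REPEATED form `(n, n)`

Deleting only the pairwise clause of `IsNondegenerateSystem` (keeping `ψ̇ᵢ ≠ 0`) is already fatal:
for `Ψ = (n, n)` the sum is `Σ_{n ≤ N} Λ(n)² ≍ N log N`, super-linear, while the main term is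
`β_∞ · 𝔖(Ψ)` with `𝔖(Ψ)` SOME real number (the partial products `∏_{p ≤ x} p/(p−1)` diverge, so
`limUnder` returns an unspecified value) — whatever that value `c` is, `|S − (N−1)c| ≤ (N−1)c + N`
fails once `log N > 8|c| + 4`. (Proportional pairs with ratio `≠ 1` are harmless: ratio `−1` empties the
positivity region, any other ratio creates a local obstruction and leaves `O(log N)` prime-power points;
so "no form repeated" is the exact content of the clause for this statement.) Prime input: the prime
number theorem for `ϑ` (tree `chebyshevTheta_isEquivalent`) and Chebyshev's bound `ϑ(x) ≤ x log 4`
(Mathlib) — used only through `ϑ(N) − ϑ(√N) ≥ ¾ N`.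
-/

/-- The repeated-form system `(n, n)` (`t = 2`): coefficients non-zero, NOT non-degenerate. -/
def rep : Fin 2 → AffLinForm 1 := fun _ => ⟨fun _ => 1, 0⟩

/-- `ψᵢ(n) = n₀` for both forms. -/
theorem rep_eval (i : Fin 2) (n : Fin 1 → ℤ) : (rep i).eval n = n 0 := by
  simp [rep, AffLinForm.eval]

/-- `ψᵢ(x) = x₀` on `ℝ¹`. -/
theorem rep_realEval (i : Fin 2) (x : Fin 1 → ℝ) : (rep i).realEval x = x 0 := by
  simp [rep, AffLinForm.realEval]

/-- The linear coefficients of `(n, n)` are non-zero (first clause of non-degeneracy holds). -/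
theorem rep_coeff_ne_zero (i : Fin 2) : (rep i).coeff ≠ 0 := fun h => by
  simpa [rep] using congr_fun h 0

/-- `(n, n)` violates the second clause of non-degeneracy (`1·ψ₀ = 1·ψ₁`). -/
theorem not_isNondegenerateSystem_rep : ¬ IsNondegenerateSystem rep := by
  intro h
  have := (h.2 0 1 (by decide) 1 1 fun n => rfl).1
  exact one_ne_zero this

/-- `‖(n, n)‖_N = 2`. -/
theorem affLinSize_rep (N : ℝ) : affLinSize rep N = 2 := by
  simp [affLinSize, rep]

/-- `β_∞((n,n); [1, N]) = N − 1` for `N ≥ 1`. -/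
theorem archFactor_rep_seg {N : ℕ} (hN : 1 ≤ N) : archFactor rep (seg 1 N) = N - 1 := by
  unfold archFactor
  have hN' : (1 : ℝ) ≤ N := by exact_mod_cast hN
  have hset : seg 1 N ∩ {x | ∀ i, 0 < (rep i).realEval x} = seg 1 N := by
    refine Set.inter_eq_left.mpr fun x hx i => ?_
    rw [mem_seg] at hx
    rw [rep_realEval]
    linarith [hx.1]
  rw [hset, seg, Real.volume_Icc_pi_toReal (fun _ => hN')]
  simp

/-- The large primes `√N < p ≤ N`. -/
def bigPrimes (N : ℕ) : Finset ℕ := (Nat.primesLE N).filter (fun p => Nat.sqrt N < p)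

/-- **Sub-sum bound**: `S((n,n); [1,N], N) ≥ Σ_{√N < p ≤ N} (log p)²` (drop all lattice points but the
large primes; every term is `≥ 0`). -/
theorem sum_bigPrimes_le_vonMangoldtSum_rep (N : ℕ) :
    ∑ p ∈ bigPrimes N, Real.log p ^ 2 ≤ vonMangoldtSum rep (seg 1 N) N := by
  unfold vonMangoldtSum
  set emb : ℕ → (Fin 1 → ℤ) := fun m _ => (m : ℤ) with hemb
  have hinj : ∀ x ∈ bigPrimes N, ∀ y ∈ bigPrimes N, emb x = emb y → x = y := by
    intro x _ y _ hxy
    have := congr_fun hxy 0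
    simpa [hemb] using this
  have hval : ∀ p ∈ bigPrimes N, ∏ i, intVonMangoldt ((rep i).eval (emb p)) = Real.log p ^ 2 := by
    intro p hp
    have hpP : p.Prime := (Nat.mem_primesLE.mp (Finset.mem_filter.mp hp).1).2
    simp [rep_eval, hemb, intVonMangoldt, ArithmeticFunction.vonMangoldt_apply_prime hpP, sq]
  have himg : ∑ n ∈ (bigPrimes N).image emb, ∏ i, intVonMangoldt ((rep i).eval n) =
      ∑ p ∈ bigPrimes N, ∏ i, intVonMangoldt ((rep i).eval (emb p)) := Finset.sum_image hinj
  rw [← Finset.sum_congr rfl hval, ← himg]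
  refine Finset.sum_le_sum_of_subset_of_nonneg ?_ fun n _ _ =>
    Finset.prod_nonneg fun i _ => ArithmeticFunction.vonMangoldt_nonneg
  intro n hn
  rw [Finset.mem_image] at hn
  obtain ⟨p, hp, rfl⟩ := hn
  have hp' := Nat.mem_primesLE.mp (Finset.mem_filter.mp hp).1
  have hp1 : (1 : ℝ) ≤ p := by exact_mod_cast hp'.2.one_le
  have hpN : (p : ℝ) ≤ N := by exact_mod_cast hp'.1
  rw [Finset.mem_filter]
  refine ⟨?_, ?_⟩
  · simp only [latticeBox, Fintype.mem_piFinset, Finset.mem_Icc, hemb]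
    intro i
    constructor <;> omega
  · rw [mem_seg]
    simp only [realPoint, hemb, Int.cast_natCast]
    exact ⟨hp1, hpN⟩

/-- `Σ_{√N < p ≤ N} log p = ϑ(N) − ϑ(√N)` (`√N` the integer square root). -/
theorem sum_bigPrimes_log (N : ℕ) :
    ∑ p ∈ bigPrimes N, Real.log p = Chebyshev.theta N - Chebyshev.theta (Nat.sqrt N) := by
  rw [Chebyshev.theta_eq_sum_primesLE_log, Chebyshev.theta_eq_sum_primesLE_log, bigPrimes,
    eq_sub_iff_add_eq, ← Finset.sum_filter_add_sum_filter_not (Nat.primesLE N) (fun p => Nat.sqrt N < p)]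
  congr 2
  ext p
  simp only [Finset.mem_filter, Nat.mem_primesLE, not_lt]
  constructor
  · rintro ⟨hle, hp⟩
    exact ⟨⟨hle.trans (Nat.sqrt_le_self N), hp⟩, hle⟩
  · rintro ⟨⟨-, hp⟩, hle⟩
    exact ⟨hle, hp⟩

/-- For `p > √N` (integer square root): `log N < 2 log p`. -/
theorem log_lt_two_mul_log {N p : ℕ} (hN : 1 ≤ N) (hp : Nat.sqrt N < p) :
    Real.log N < 2 * Real.log p := by
  have h1 : N < p * p := lt_of_lt_of_le (Nat.lt_succ_sqrt N) (Nat.mul_self_le_mul_self hp)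
  have h2 : (N : ℝ) < (p : ℝ) ^ 2 := by exact_mod_cast (sq p ▸ h1 : N < p ^ 2)
  have hN0 : (0 : ℝ) < N := by exact_mod_cast hN
  calc Real.log N < Real.log ((p : ℝ) ^ 2) := Real.log_lt_log hN0 h2
    _ = 2 * Real.log p := by rw [Real.log_pow]; norm_num

/-- **`S((n,n); [1,N], N) ≥ ½ log N · (ϑ(N) − ϑ(√N))`.** -/
theorem vonMangoldtSum_rep_ge {N : ℕ} (hN : 1 ≤ N) :
    Real.log N / 2 * (Chebyshev.theta N - Chebyshev.theta (Nat.sqrt N)) ≤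
      vonMangoldtSum rep (seg 1 N) N := by
  refine le_trans ?_ (sum_bigPrimes_le_vonMangoldtSum_rep N)
  rw [← sum_bigPrimes_log, Finset.mul_sum]
  refine Finset.sum_le_sum fun p hp => ?_
  have hp' := Finset.mem_filter.mp hp
  have hpP : p.Prime := (Nat.mem_primesLE.mp hp'.1).2
  have hlogp : 0 ≤ Real.log p := Real.log_nonneg (by exact_mod_cast hpP.one_le)
  have hlt := log_lt_two_mul_log hN hp'.2
  rw [sq]
  nlinarith

/-- PNT input: for all large `N`, `ϑ(N) − ϑ(√N) ≥ ¾ N` (`ϑ(N) ≥ 0.9 N` eventually by the prime number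
theorem for `ϑ`, tree `chebyshevTheta_isEquivalent`; `ϑ(√N) ≤ √N log 4 ≤ 0.14 N` for `N ≥ 100` by
Chebyshev's bound, Mathlib `Chebyshev.theta_le_log4_mul_x`). -/
theorem eventually_theta_sub_theta_sqrt_ge :
    ∃ N₁ : ℕ, ∀ N : ℕ, N₁ ≤ N →
      3 / 4 * (N : ℝ) ≤ Chebyshev.theta N - Chebyshev.theta (Nat.sqrt N) := by
  have hθ := Literature.NumberTheory.LFunctions.chebyshevTheta_isEquivalent
  have ho := (Asymptotics.isLittleO_iff.mp hθ.isLittleO) (by norm_num : (0 : ℝ) < 1 / 10)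
  obtain ⟨X, hX⟩ := Filter.eventually_atTop.mp ho
  refine ⟨max ⌈X⌉₊ 100, fun N hN => ?_⟩
  have hN100 : 100 ≤ N := le_of_max_le_right hN
  have hNX : X ≤ (N : ℝ) := (Nat.le_ceil X).trans (by exact_mod_cast le_of_max_le_left hN)
  have h1 := hX N hNX
  simp only [Pi.sub_apply, Real.norm_eq_abs] at h1
  have hN0 : (0 : ℝ) ≤ (N : ℝ) := Nat.cast_nonneg N
  rw [abs_of_nonneg hN0] at h1
  have h1' := (abs_le.mp h1).1
  -- `ϑ(√N) ≤ log 4 · √N ≤ 1.4 · N/10`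
  set M := Nat.sqrt N with hM
  have hM10 : 10 ≤ M := by
    rw [hM, Nat.le_sqrt]
    exact hN100
  have hMM : M * M ≤ N := Nat.sqrt_le N
  have hMN : 10 * (M : ℝ) ≤ N := by
    have : 10 * M ≤ M * M := Nat.mul_le_mul_right M hM10
    exact_mod_cast this.trans hMM
  have h2 := Chebyshev.theta_le_log4_mul_x (Nat.cast_nonneg M)
  have hlog4 : Real.log 4 < 1.4 := by
    have : Real.log 4 = 2 * Real.log 2 := by
      rw [show (4 : ℝ) = 2 ^ 2 by norm_num, Real.log_pow]; norm_num
    rw [this]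
    have := Real.log_two_lt_d9
    linarith
  have hM0 : (0 : ℝ) ≤ M := Nat.cast_nonneg M
  nlinarith

/-- The crux with non-degeneracy WEAKENED to its first clause (all linear coefficients non-zero). -/
def RelativeDimOneWithoutNonproportional : Prop :=
  ∀ (t L : ℕ), 1 ≤ t → ∀ ε : ℝ, 0 < ε → ∃ N₀ : ℕ, ∀ N : ℕ, N₀ ≤ N →
    ∀ Ψ : Fin t → AffLinForm 1, (∀ i, (Ψ i).coeff ≠ 0) → affLinSize Ψ N ≤ L →
      ∀ K : Set (Fin 1 → ℝ), Convex ℝ K → K ⊆ realBox 1 N → Concl ε N Ψ K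

/-- Sanity: the variant is the crux minus the pairwise clause (it implies the crux). -/
theorem relativeDimOneWithoutNonproportional_imp :
    RelativeDimOneWithoutNonproportional → RelativeDimOne := by
  intro h t L ht ε hε
  obtain ⟨N₀, hN₀⟩ := h t L ht ε hε
  exact ⟨N₀, fun N hN Ψ hΨ hL K hK hKN => hN₀ N hN Ψ hΨ.1 hL K hK hKN⟩

/-- **The pairwise (non-proportionality) clause is load-bearing.** Witness: `t = 2`, `Ψ = (n, n)`
(`‖Ψ‖_N = 2`), `K = [1, N]`: `S = Σ_{n ≤ N} Λ(n)² ≥ ⅜ N log N` while the main term is `(N − 1)·c` for the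
FIXED real `c = 𝔖(n,n)` (a `limUnder` of the divergent `∏_{p≤x} p/(p−1)`, value irrelevant): at `ε = 1`,
`|S − (N−1)c| ≤ (N−1)c + N` forces `⅜ log N ≤ 2|c| + 1`, false for `log N > 8|c| + 4`. -/
theorem relativeDimOne_false_without_nonproportional : ¬ RelativeDimOneWithoutNonproportional := by
  intro h
  obtain ⟨N₀, hN₀⟩ := h 2 2 (by norm_num) 1 one_pos
  obtain ⟨N₁, hN₁⟩ := eventually_theta_sub_theta_sqrt_ge
  set c : ℝ := singularProduct rep with hc
  set N : ℕ := max (max N₀ N₁) (⌈Real.exp (8 * |c| + 4)⌉₊ + 1) with hNdef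
  have hNN₀ : N₀ ≤ N := (le_max_left _ _).trans (le_max_left _ _)
  have hNN₁ : N₁ ≤ N := (le_max_right _ _).trans (le_max_left _ _)
  have hNexp : Real.exp (8 * |c| + 4) < N := by
    have h1 : ((⌈Real.exp (8 * |c| + 4)⌉₊ + 1 : ℕ) : ℝ) ≤ N := by exact_mod_cast le_max_right _ _
    push_cast at h1
    linarith [Nat.le_ceil (Real.exp (8 * |c| + 4))]
  have hlogN : 8 * |c| + 4 < Real.log N := by
    rw [← Real.log_exp (8 * |c| + 4)]
    exact Real.log_lt_log (Real.exp_pos _) hNexp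
  have hN1 : 1 ≤ N := le_trans (by omega) (le_max_right _ _)
  have hN1r : (1 : ℝ) ≤ N := by exact_mod_cast hN1
  have key := hN₀ N hNN₀ rep rep_coeff_ne_zero (by rw [affLinSize_rep]; norm_num) (seg 1 N)
    (convex_seg _ _)
    (seg_subset_realBox (by linarith) le_rfl)
  unfold Concl at key
  rw [archFactor_rep_seg hN1] at key
  have hS := vonMangoldtSum_rep_ge hN1
  have hθ := hN₁ N hNN₁
  set S := vonMangoldtSum rep (seg 1 N) N with hSdef
  -- from `key`: `S ≤ 2 (N-1) c + N ≤ (2|c| + 1) N`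
  have hup : S ≤ (2 * |c| + 1) * N := by
    have h1 := (abs_le.mp key).2
    have h2 : ((N : ℝ) - 1) * c ≤ N * |c| := by
      have := le_abs_self c
      have h3 : ((N : ℝ) - 1) * c ≤ ((N : ℝ) - 1) * |c| :=
        mul_le_mul_of_nonneg_left this (by linarith)
      nlinarith [abs_nonneg c]
    nlinarith
  -- from `hS`, `hθ`: `S ≥ (3/8) N log N`
  have hlogN0 : 0 ≤ Real.log N := Real.log_nonneg hN1r
  have hlow : 3 / 8 * (N : ℝ) * Real.log N ≤ S := by nlinarith
  -- contradiction with `log N > 8|c| + 4`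
  have hN0 : (0 : ℝ) < N := by linarith
  nlinarith [abs_nonneg c]

/-! ## §B3 (contrast to B2) Uniformity of `N₀` in `t` is AUTOMATIC: `‖Ψ‖_N ≥ t` -/

/-- A non-degenerate `d = 1` system of `t` forms has size `‖Ψ‖_N ≥ t` (each `|ψ̇ᵢ(e₀)| ≥ 1`). -/
theorem card_le_affLinSize {t : ℕ} {Ψ : Fin t → AffLinForm 1} (hΨ : IsNondegenerateSystem Ψ) (N : ℝ) :
    (t : ℝ) ≤ affLinSize Ψ N := by
  unfold affLinSize
  have h1 : ∀ i, (1 : ℝ) ≤ ∑ j, |((Ψ i).coeff j : ℝ)| := by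
    intro i
    rw [Fin.sum_univ_one]
    have hne : (Ψ i).coeff 0 ≠ 0 := by
      intro h0
      refine hΨ.1 i (funext fun j => ?_)
      rw [Fin.fin_one_eq_zero j]
      simpa using h0
    have : (1 : ℤ) ≤ |(Ψ i).coeff 0| := Int.one_le_abs hne
    rw [← Int.cast_abs]
    exact_mod_cast this
  have h3 : 0 ≤ ∑ i, |((Ψ i).const : ℝ) / N| := Finset.sum_nonneg fun i _ => abs_nonneg _
  calc (t : ℝ) = ∑ _i : Fin t, (1 : ℝ) := by simp
    _ ≤ ∑ i, ∑ j, |((Ψ i).coeff j : ℝ)| := Finset.sum_le_sum fun i _ => h1 i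
    _ ≤ _ := le_add_of_nonneg_right h3

/-- The crux with `N₀` chosen BEFORE `t` (uniformity in the number of forms). -/
def RelativeDimOneUniformInT : Prop :=
  ∀ L : ℕ, ∀ ε : ℝ, 0 < ε → ∃ N₀ : ℕ, ∀ t : ℕ, 1 ≤ t → ∀ N : ℕ, N₀ ≤ N →
    ∀ Ψ : Fin t → AffLinForm 1, IsNondegenerateSystem Ψ → affLinSize Ψ N ≤ L →
      ∀ K : Set (Fin 1 → ℝ), Convex ℝ K → K ⊆ realBox 1 N → Concl ε N Ψ K

/-- **Uniformity in `t` costs nothing** (contrast: uniformity in `L` is false, B2): since `‖Ψ‖_N ≥ t`,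
only `t ≤ L` is inhabited, and `N₀(L, ε) := max_{t ≤ L} N₀(t, L, ε)` serves all `t`. So the crux is
EQUIVALENT to its `t`-uniform form; the parameter `t` in the threshold is redundant. -/
theorem relativeDimOneUniformInT_iff : RelativeDimOneUniformInT ↔ RelativeDimOne := by
  constructor
  · intro h t L ht ε hε
    obtain ⟨N₀, hN₀⟩ := h L ε hε
    exact ⟨N₀, hN₀ t ht⟩
  · intro h L ε hε
    choose N₀ hN₀ using fun t : ℕ => h (t + 1) L (Nat.le_add_left 1 t) ε hε
    refine ⟨(Finset.range L).sup N₀, fun t ht N hN Ψ hΨ hL K hK hKN => ?_⟩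
    obtain ⟨t, rfl⟩ : ∃ t', t = t' + 1 := ⟨t - 1, by omega⟩
    by_cases htL : t < L
    · exact hN₀ t N ((Finset.le_sup (Finset.mem_range.mpr htL)).trans hN) Ψ hΨ hL K hK hKN
    · exfalso
      have h1 := card_le_affLinSize hΨ N
      have h2 : (L : ℝ) < (t + 1 : ℕ) := by exact_mod_cast (show L < t + 1 by omega)
      linarith

/-! ## §B1′ The absolute slack must exceed `log N`: slack `ε·log N` is FALSE -/

/-- The one-point body `{(m)} ⊆ ℝ¹`. -/
def ptAt (m : ℤ) : Set (Fin 1 → ℝ) := {fun _ => (m : ℝ)}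

/-- A singleton is convex. -/
theorem convex_ptAt (m : ℤ) : Convex ℝ (ptAt m) := convex_singleton _

/-- `{(m)} ⊆ [-N, N]` for `|m| ≤ N`. -/
theorem ptAt_subset_realBox {m : ℤ} {N : ℕ} (h1 : -(N : ℤ) ≤ m) (h2 : m ≤ N) : ptAt m ⊆ realBox 1 N := by
  intro x hx
  rw [ptAt, Set.mem_singleton_iff] at hx
  subst hx
  have h1' : -(N : ℝ) ≤ m := by exact_mod_cast h1
  have h2' : (m : ℝ) ≤ N := by exact_mod_cast h2
  simp only [realBox, Set.mem_Icc, Pi.le_def, Fin.forall_fin_one]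
  exact ⟨h1', h2'⟩

/-- The lattice points with real point `(m)` are exactly `{(m)}` (for `|m| ≤ N`). -/
theorem filter_ptAt {m : ℤ} {N : ℕ} (h1 : -(N : ℤ) ≤ m) (h2 : m ≤ N) :
    (latticeBox 1 N).filter (fun n => realPoint n ∈ ptAt m) = {fun _ => m} := by
  ext n
  simp only [Finset.mem_filter, Finset.mem_singleton, ptAt, Set.mem_singleton_iff, latticeBox,
    Fintype.mem_piFinset, Finset.mem_Icc]
  constructor
  · rintro ⟨-, h⟩
    funext i
    have hi := congr_fun h i
    simp only [realPoint] at hi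
    exact_mod_cast hi
  · rintro rfl
    exact ⟨fun _ => ⟨h1, h2⟩, funext fun _ => by simp [realPoint]⟩

/-- `S(n; {(p)}, N) = Λ(p)` for `0 ≤ p ≤ N`. -/
theorem vonMangoldtSum_id_ptAt {p N : ℕ} (hp : p ≤ N) :
    vonMangoldtSum (lin 1 0) (ptAt p) N = ArithmeticFunction.vonMangoldt p := by
  unfold vonMangoldtSum
  rw [filter_ptAt (by omega) (by exact_mod_cast hp), Finset.sum_singleton]
  simp [lin_eval, intVonMangoldt]

/-- `β_∞(Ψ; {(m)}) = 0`: a point has length zero. -/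
theorem archFactor_ptAt {t : ℕ} (Ψ : Fin t → AffLinForm 1) (m : ℤ) : archFactor Ψ (ptAt m) = 0 := by
  unfold archFactor
  rw [ENNReal.toReal_eq_zero_iff]
  left
  refine measure_mono_null (t := Set.Icc (fun _ => (m : ℝ)) (fun _ => (m : ℝ))) ?_ ?_
  · intro x hx
    have hx1 : x = fun _ => (m : ℝ) := by simpa [ptAt] using hx.1
    subst hx1
    simp only [Set.mem_Icc, le_refl, and_self]
  · rw [Real.volume_Icc_pi]
    simp

/-- The crux with the absolute slack `εN` strengthened to `ε log N`. -/
def RelativeDimOneLogSlack : Prop :=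
  ∀ (t L : ℕ), 1 ≤ t → ∀ ε : ℝ, 0 < ε → ∃ N₀ : ℕ, ∀ N : ℕ, N₀ ≤ N →
    ∀ Ψ : Fin t → AffLinForm 1, IsNondegenerateSystem Ψ → affLinSize Ψ N ≤ L →
      ∀ K : Set (Fin 1 → ℝ), Convex ℝ K → K ⊆ realBox 1 N →
        |vonMangoldtSum Ψ K N - archFactor Ψ K * singularProduct Ψ| ≤
          ε * (archFactor Ψ K * singularProduct Ψ + Real.log N)

/-- **An absolute slack of size `log N` does not suffice** (sharpening of B1): `ψ = n`, `K = {(p)}` with `p`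
a prime in `(N/2, N]` (Bertrand): `S = log p > ½ log N` while `β_∞ = 0`, so `|S − 0| ≤ ½ (0 + log N)` fails.
So the minimal absolute slack `g(N)` of a true statement `|S − β_∞𝔖| ≤ ε(β_∞𝔖 + g(N))` lies in
`(log N, N]` (in truth above every `log^A N`, Maier 1985 — not formalised). -/
theorem not_relativeDimOneLogSlack : ¬ RelativeDimOneLogSlack := by
  intro h
  obtain ⟨N₀, hN₀⟩ := h 1 1 le_rfl (1 / 2) (by norm_num)
  obtain ⟨n, hnN₀, hn4⟩ : ∃ n : ℕ, N₀ ≤ n ∧ 4 ≤ n := ⟨max N₀ 4, le_max_left _ _, le_max_right _ _⟩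
  obtain ⟨p, hp, hnp, hp2n⟩ := Nat.exists_prime_lt_and_le_two_mul n (by omega)
  have hN : N₀ ≤ 2 * n := by omega
  have key := hN₀ (2 * n) hN (lin 1 0) (isNondegenerateSystem_lin one_ne_zero 0)
    (by rw [affLinSize_lin]; simp) (ptAt p) (convex_ptAt _)
    (ptAt_subset_realBox (N := 2 * n) (m := p) (by omega) (by exact_mod_cast hp2n))
  rw [vonMangoldtSum_id_ptAt hp2n, archFactor_ptAt, ArithmeticFunction.vonMangoldt_apply_prime hp] at key
  simp only [zero_mul, sub_zero, zero_add] at key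
  -- `log p ≤ ½ log (2n)` contradicts `p² > 2n`
  have hp0 : (0 : ℝ) < p := by exact_mod_cast hp.pos
  have hsq : ((2 * n : ℕ) : ℝ) < (p : ℝ) ^ 2 := by
    have : 2 * n < p * p := by nlinarith
    exact_mod_cast (sq p ▸ this : 2 * n < p ^ 2)
  have hlog : Real.log ((2 * n : ℕ) : ℝ) < 2 * Real.log p := by
    calc Real.log ((2 * n : ℕ) : ℝ) < Real.log ((p : ℝ) ^ 2) :=
          Real.log_lt_log (by positivity) hsq
      _ = 2 * Real.log p := by rw [Real.log_pow]; norm_num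
  rw [abs_of_nonneg (Real.log_nonneg (by exact_mod_cast hp.one_le))] at key
  linarith

end Summit.Parity.GeneralizedHardyLittlewood.Cruxes.RelativeDimOne.Disproof
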